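import Mathlib.Analysis.SpecialFunctions.Trigonometric.DerivHyp
import Mathlib.Analysis.SpecialFunctions.Exponential
import Mathlib.Analysis.Complex.ExponentialBounds
import HarnessLib

/-!
# `WeilGroundState.GroundStatesConvergeToXi` — sign of the signed Doob kernel
(crux item stmt-RiemannHypothesis-1527, route route-RiemannHypothesis-WeilGroundState; line `Sketch`,
stub `stub_doobKernel_sign` (E3); `--supports`)

The signed archimedean–polar Lévy kernel of the Doob form is
`J(h) = e^{h/2} / (2 sinh h) − 2 cosh (h/2)`.  We show `J > 0` on `(0, 1/4]` and `J < 0` on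
`[1/3, ∞)` by elementary real analysis:

* short range: with `x = e^h`, `J(h) > 0 ⟺ x³ < x + 1`, and `x ≤ e^{1/4} ≤ 21/16` gives it;
* long range: `cosh ≥ 1`, `e^{h/2} ≥ 7/6`, `e^{-h} ≤ 3/4` give `e^{h/2} < 4 sinh h ≤ 4 cosh(h/2) sinh h`.

No new definitions; no named fact is used (Mathlib only).
-/

noncomputable section

set_option linter.dupNamespace false

namespace Summit.RiemannHypothesis.RiemannHypothesis.Theorems.GroundStatesConvergeToXi

open Real

/-- Numerical bound `exp (1/4) ≤ 21/16`, from `|exp x - 1 - x| ≤ x²` on `|x| ≤ 1`. [folklore] -/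
theorem doobK_exp_quarter_le : Real.exp (1 / 4) ≤ 21 / 16 := by
  have h := Real.abs_exp_sub_one_sub_id_le (x := (1 / 4 : ℝ))
    (by rw [abs_of_nonneg (by norm_num)]; norm_num)
  have h2 := (abs_le.mp h).2
  linarith

/-- Key cubic inequality behind the short-range sign: for `h ≤ 1/4` and `x = exp h`,
`x ^ 3 < x + 1` (i.e. `exp (3h) < exp h + 1`). [folklore] -/
theorem doobK_cubic_lt (h : ℝ) (h1 : h ≤ 1 / 4) :
    Real.exp h ^ 3 < Real.exp h + 1 := by
  have hx0 : 0 < Real.exp h := Real.exp_pos h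
  have hxc : Real.exp h ≤ 21 / 16 :=
    (Real.exp_le_exp.mpr h1).trans doobK_exp_quarter_le
  nlinarith [mul_nonneg (sub_nonneg.2 hxc) (sq_nonneg (Real.exp h)),
    mul_nonneg (sub_nonneg.2 hxc) hx0.le]

/-- Short range: the signed kernel `e^{h/2}/(2 sinh h) − 2 cosh(h/2)` is positive on `(0, 1/4]`.
[folklore] -/
theorem doobK_short (h : ℝ) (h0 : 0 < h) (h1 : h ≤ 1 / 4) :
    2 * Real.cosh (h / 2) < Real.exp (h / 2) / (2 * Real.sinh h) := by
  have hs : 0 < Real.sinh h := Real.sinh_pos_iff.mpr h0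
  rw [lt_div_iff₀ (by positivity), Real.cosh_eq, Real.sinh_eq, Real.exp_neg, Real.exp_neg]
  have hexp : Real.exp h = Real.exp (h / 2) ^ 2 := by
    rw [sq, ← Real.exp_add, add_halves]
  have key := doobK_cubic_lt h h1
  rw [hexp] at key ⊢
  obtain ⟨a, ha⟩ : ∃ a, a = Real.exp (h / 2) := ⟨_, rfl⟩
  have ha0 : 0 < a := ha ▸ Real.exp_pos _
  rw [← ha] at key ⊢
  have e : 2 * ((a + a⁻¹) / 2) * (2 * ((a ^ 2 - (a ^ 2)⁻¹) / 2)) =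
      (a ^ 2 + 1) * (a ^ 4 - 1) / a ^ 3 := by
    field_simp
  rw [e, div_lt_iff₀ (by positivity)]
  nlinarith [key]

/-- Long range: the signed kernel `e^{h/2}/(2 sinh h) − 2 cosh(h/2)` is negative on `[1/3, ∞)`.
[folklore] -/
theorem doobK_long (h : ℝ) (h1 : 1 / 3 ≤ h) :
    Real.exp (h / 2) / (2 * Real.sinh h) < 2 * Real.cosh (h / 2) := by
  have h0 : 0 < h := by linarith
  have hs : 0 < Real.sinh h := Real.sinh_pos_iff.mpr h0
  rw [div_lt_iff₀ (by positivity)]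
  have hc : 1 ≤ Real.cosh (h / 2) := Real.one_le_cosh _
  have ha : 7 / 6 ≤ Real.exp (h / 2) := by
    have := Real.add_one_le_exp (h / 2)
    linarith
  have hb : Real.exp (-h) ≤ 3 / 4 := by
    have h1' := Real.add_one_le_exp h
    have hmul : Real.exp (-h) * Real.exp h = 1 := by
      rw [← Real.exp_add, neg_add_cancel, Real.exp_zero]
    have := Real.exp_pos (-h)
    nlinarith
  have hexp : Real.exp h = Real.exp (h / 2) ^ 2 := by
    rw [sq, ← Real.exp_add, add_halves]
  have hsinh : Real.sinh h = (Real.exp (h / 2) ^ 2 - Real.exp (-h)) / 2 := by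
    rw [Real.sinh_eq, hexp]
  rw [hsinh] at hs ⊢
  nlinarith [mul_nonneg (sub_nonneg.2 hc) hs.le,
    mul_nonneg (sub_nonneg.2 ha) (by positivity : (0 : ℝ) ≤ 2 * Real.exp (h / 2) + 4 / 3)]

/-- **Stub `stub_doobKernel_sign` (E3).** Sign structure of the signed archimedean–polar Lévy
kernel `J(h) = e^{h/2}/(2 sinh h) − 2 cosh(h/2)` of the Doob form of Weil's quadratic form
conjugated by Riemann's kernel: `J > 0` on `(0, 1/4]` (the `1/(2h)` singularity of the archimedean
jump density wins) and `J < 0` on `[1/3, ∞)` (the polar rate `2 cosh(h/2)` wins). [folklore] -/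
theorem stub_doobKernel_sign :
    (∀ h : ℝ, 0 < h → h ≤ 1 / 4 → 2 * Real.cosh (h / 2) < Real.exp (h / 2) / (2 * Real.sinh h)) ∧
    (∀ h : ℝ, 1 / 3 ≤ h → Real.exp (h / 2) / (2 * Real.sinh h) < 2 * Real.cosh (h / 2)) :=
  ⟨doobK_short, doobK_long⟩

end Summit.RiemannHypothesis.RiemannHypothesis.Theorems.GroundStatesConvergeToXi
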